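import Literature.Algebra.Lie.Sp4GraphIntertwiner
import Literature.Geometry.Kaehler.ComplexTorusNonSimpleAbelianFourfoldConditionD
import Literature.Geometry.Kaehler.ComplexTorusHodgeGeneralTimesSameDimension
import Literature.Geometry.Kaehler.ComplexTorusAbelianSurfaceHodgeGeneral
import Literature.Geometry.Kaehler.ComplexTorusHodgeGeneralIntrinsicHodgeGroup
import Literature.Geometry.Kaehler.ComplexTorusHodgeGroupProductLieSimpleFactor
import Literature.Geometry.Kaehler.ComplexTorusHodgeGroupProductLieKernels
import Literature.Geometry.Kaehler.ComplexTorusHodgeLieAlgebraSiegelDimension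
import Literature.Geometry.Kaehler.ComplexTorusMumfordTateComplexLieAlgebraRatForm
import Literature.Geometry.Kaehler.ComplexTorusHodgeGroupLieAlgebraAlgebraic
import Literature.Geometry.Kaehler.ComplexTorusEndomorphismAlgebraProduct
import Literature.Geometry.Kaehler.ComplexTorusHodgeGeneralEndomorphisms
import Literature.Geometry.Kaehler.ComplexTorusHodgeLieAlgebraHodgeTypes
import Literature.Geometry.Kaehler.ComplexTorusAnalyticClassesPowersConditionD
import Literature.Geometry.Kaehler.ComplexTorusRationalFormsBasis
import Literature.NumberTheory.Automorphic.LieAlgebraGLDimension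
import HarnessLib

/-!
# Two Hodge-general abelian surfaces: `Hg(S₁ × S₂) = Hg(S₁) × Hg(S₂)` unless `S₁ ∼ S₂` (Moonen–Zarhin (3.3)–(3.4) for `𝔰𝔭₄ × 𝔰𝔭₄`)

Lane `lit-hodgefound`, seat p17, generation 52, self-proposed row g52-#2 — the CONSUMER of g52-#1 ∕ g52-#1b
(`Literature/Algebra/Lie/Sp4GraphIntertwiner.lean`, the graph lemma for `𝔰𝔭₄`).  It closes the product case of
Moonen–Zarhin's Theorem (0.1)(4) that g51-#7 (`ComplexTorusNonSimpleAbelianFourfoldConditionD`) had to leave open for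
`X ∼ Y₁ × Y₂` with `Y₁`, `Y₂` SIMPLE, NON-ISOGENOUS abelian surfaces, in the sub-case where one factor is of type I(1)
(`End_ℚ = ℚ`, `Hg = Sp₄`).  THEOREMS ONLY (no definition, no instance, no notation, no named fact; D-0026 net debt 0).

## The argument (Moonen–Zarhin §3 (3.1), Lemma (3.3) and its proof, Lemma (3.4))

Let `S₁`, `S₂` be complex abelian surfaces with `End_ℚ(Sᵢ) = ℚ`, so `Hg(Sᵢ) = Sp(Vᵢ, Eᵢ) ≅ Sp₄` and
`𝔤ᵢ := Lie Hg(Sᵢ)(ℂ) = 𝔰𝔭₄(ℂ)` is simple (the tree's `ComplexTorusAbelianSurfaceHodgeGeneral`,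
`ComplexTorusHodgeGeneralIntrinsicHodgeGroup`).  By (3.1) `𝔤 := Lie Hg(S₁ × S₂)(ℂ) ⊆ 𝔤₁ × 𝔤₂` projects ONTO both factors
(`exists_lieHom_toBlocks`), and if `Hg(S₁ × S₂) ≠ Hg(S₁) × Hg(S₂)` then both kernels `Lie Kᵢ` vanish (`Kᵢ°` is a connected
normal subgroup of the almost simple `Hg(Sᵢ)(ℂ)`, `ComplexTorusHodgeGroupProductDimensionSplitting`), i.e. `𝔤 = Γ_φ` is the
GRAPH of an isomorphism `φ : 𝔰𝔭(V₁,E₁)_ℂ ⥲ 𝔰𝔭(V₂,E₂)_ℂ`; moreover `𝔤 ∋ J_{S₁×S₂} ⊗ 1 = (J₁, J₂)` («`Γ_{φ,ℂ} ∋ J_{X×Y} = (J_X, J_Y)`»,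
proof of (3.3), p0006 L126–L129).  In symplectic coordinates (`IsRiemannForm.exists_conj_jMatrix_latticeGram_eq`: `QJP = -J₀`,
`ᵗPGP = -J₀`) this is exactly the situation of the graph lemma `Sp4Graph.exists_intertwiner_of_graph₂`: `φ` is conjugation by
an invertible `g`, so `T := P₂ g Q₁ : V₁,ℂ → V₂,ℂ` is a NON-ZERO matrix with `Z₂₂ T = T Z₁₁` for all `Z = (Z₁₁, Z₂₂) ∈ 𝔤`.
Then `(0 0; T 0)` commutes with `𝔤`, hence lies in `End(V_ℂ)^𝔤 = End_ℚ(S₁ × S₂) ⊗ ℂ` (Lange Ex. 7.2.4 (3) ⊗ ℂ, the tree's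
`forall_hodgeGroupComplexLie_comm_iff_mem_span_endAlgRat`), whose lower-left blocks are spanned by `Hom_ℚ(S₁, S₂)`
(`mem_endAlgRat_prod_iff`): so `Hom_ℚ(S₁, S₂) ≠ 0` («the fact that `Γ_{φ,ℂ} ∋ J` … some multiple of `φ` corresponds to an
isogeny», Lemma (3.4) «Then either `Hom(X₁, X₂) ≠ 0` …»), and two simple surfaces with a non-zero homomorphism are isogenous
(`IsSimple.homRat_eq_bot`).

Moonen–Zarhin obtain «`φ` is the standard representation» from the classification of minuscule weights [Z2, 0.4.2]; here,
for `𝔰𝔭₄`, that uniqueness is the hand-proved graph lemma of g52-#1 (Jacobson, *Lie algebras*, Ch. IX §5 Thms. 5–6).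

## Sources, verbatim

* B. Moonen, Yu. G. Zarhin [MoonenZarhin1999LowDim], held `paper:arxiv-math_9901113`: §3 (3.1) (p0006 L25–L51: «`𝔥𝔤(X₁ × X₂) ≅
  𝔤₁ ⊕ 𝔤₂ ⊕ Γ_φ` … We may have that `Hg(X₁ × X₂) ≠ Hg(X₁) × Hg(X₂)`. (I.e., `𝔤₃ ≠ 0` in the above.)»); proof of Lemma (3.3)
  (p0006 L126–L129: «Furthermore, `X_{F,ℂ} ≅ ⊕_{σ∈Σ_F} St` … is a direct sum of `e` copies of the standard representation …
  By [Z2, 0.4.2], using the fact that `Γ_{φ,ℂ} ∋ J_{X×Y} = (J_X, J_Y)`, we conclude … some multiple of `φ` corresponds to an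
  isogeny»); Lemma (3.4) (p0006 L133–L138: «Assume that `Hg(X₁ × X₂) ≠ Hg(X₁) × Hg(X₂)`. Then either `Hom(X₁, X₂) ≠ 0`, or …»);
  §5 (5.5) (p0009 L93–L100: «This only leaves us with the case where `X ∼ X₁ × X₂`, with `X₁` and `X₂` simple abelian surfaces.
  If `X₁` and `X₂` are isogenous then we are done.»); Thm. (0.1)(4) (p0001 L131–L135).
* Yu. G. Zarhin [Z2] = *Weights of simple Lie algebras in the cohomology of algebraic varieties*, Math. USSR Izv. 24 (1985),
  0.4.2 (minuscule weights) — replaced here by the explicit `𝔰𝔭₄` computation of `Sp4GraphIntertwiner`.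
* H. Lange [Lange2023AbelianVarietiesComplex], §7.2.4 Exercise (3) («`End_ℚ(X) = End_{Hg(X)}(H_1(X,ℚ))`»), §2.4.4 Cor. 2.4.26
  (proof: `Hom` between non-isogenous simple tori vanishes), §7.3.2 Lemma 7.3.7 (symplectic basis).

## What is proved

* §1 **`IsRiemannForm.homRat_ne_bot_of_hodgeGroupC_prod_ne_blockDiagProd_of_finrank_eq_two`**: `S₁`, `S₂` polarised abelian
  surfaces with `End_ℚ(Sᵢ) = ℚ` and `Hg(S₁ × S₂)(ℂ) ≠ Hg(S₁)(ℂ) × Hg(S₂)(ℂ)` ⟹ `Hom_ℚ(S₁, S₂) ≠ 0 ≠ Hom_ℚ(S₂, S₁)`;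
  **`IsRiemannForm.isIsogenous_of_hodgeGroupC_prod_ne_blockDiagProd_of_finrank_eq_two`** (⟹ `S₁ ∼ S₂`);
  **`IsRiemannForm.hodgeGroupC_prod_eq_blockDiagProd_of_finrank_eq_two_of_endAlgRat_eq_bot_of_not_isIsogenous`**
  (`S₁ ≁ S₂ ⟹ Hg(S₁ × S₂)(ℂ) = Hg(S₁)(ℂ) × Hg(S₂)(ℂ)`), the dichotomy `…_or_isIsogenous…`, real points, `IsAbelianVariety` twins.
* §2 CONDITION (D): **`IsAbelianVariety.forall_divisorClasses_powPeriod_prod_eq_hodgeClasses_of_finrank_eq_two_of_endAlgRat_eq_bot`**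
  — `S₁` an abelian surface with `End_ℚ(S₁) = ℚ`, `S₂` ANY abelian surface: every power of `S₁ × S₂` has its Hodge ring generated
  by divisor classes (with g51's `…_of_ne_bot` and the isogenous case); the mirror `…_of_endAlgRat_eq_bot_right`; the fourfold
  assembly **`IsRiemannForm.forall_divisorClasses_powPeriod_prod_eq_hodgeClasses_of_finrank_eq_two_of_endAlgRat_eq_bot_or`**
  (`Y₁ × Y₂` satisfies (D) whenever `End_ℚ(Y₁) = ℚ` or `End_ℚ(Y₂) = ℚ` or a factor is non-simple or `Y₂ ∼ Y₁` — what remains of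
  (0.1)(4) for `Y₁ × Y₂` is Prop. (4.2) ∕ Thm. (3.2): both factors simple, non-isogenous, with `End_ℚ ≠ ℚ`), the isogeny-class
  form and the cycle form `Aᵖ = Bᵖ` for inner-product tori isogenous to powers of `S₁ × S₂`.

## References

* [MoonenZarhin1999LowDim] B. Moonen, Yu. G. Zarhin, *Hodge classes on abelian varieties of low dimension*, Math. Ann. 315
  (1999) 711–733, §3 (3.1), Lemma (3.3)–(3.4) (arXiv v2 = Math. Ann. numbering: Lemma (3.3) = chunk p0006 L84–L131, Lemma (3.4) = p0006 L133–p0007 L7; earlier tree copies of this family wrote «(3.4)»∕«(3.5)»), §5 (5.5), Thm. (0.1)(4).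
* [Lange2023AbelianVarietiesComplex] H. Lange, *Abelian Varieties over the Complex Numbers*, Springer (2023), §2.4.4, §7.2.4, §7.3.2.
* [Jacobson1962LieAlgebras] N. Jacobson, *Lie Algebras* (1962), Ch. IX §5 Thms. 5–6.
* [Gordon1997] B. B. Gordon, *A survey of the Hodge conjecture for abelian varieties*, §2.16 Proposition (Goursat).
-/

noncomputable section

open Matrix Module

namespace Literature.Geometry.Kaehler

namespace ComplexTorus

open Literature.NumberTheory.Automorphic (lieAlgebraGL lieSubalgebraGL lie_mem_lieAlgebraGL identityComponent
  lieAlgebraGL_identityComponent lieAlgebraGL_bot)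
open Literature.Algebra.Lie

/-! ### §0 Matrix helpers (file-local) -/

section Helpers

variable {R : Type*} [CommRing R] {m m' κ : Type*} [Fintype m] [Fintype m'] [Fintype κ] [DecidableEq m] [DecidableEq κ]

omit [Fintype m'] [DecidableEq κ] in
/-- `Q(XY − YX)P = (QXP)(QYP) − (QYP)(QXP)` when `PQ = 1`. [folklore] -/
private theorem conj_mul_sub_mul₁₃₁ {P : Matrix m κ R} {Q : Matrix κ m R} (hPQ : P * Q = 1) (X Y : Matrix m m R) :
    Q * (X * Y - Y * X) * P = Q * X * P * (Q * Y * P) - Q * Y * P * (Q * X * P) := by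
  have h : ∀ X Y : Matrix m m R, Q * X * P * (Q * Y * P) = Q * (X * Y) * P := fun X Y ↦ by
    calc Q * X * P * (Q * Y * P) = Q * X * (P * Q) * Y * P := by simp only [Matrix.mul_assoc]
      _ = Q * (X * Y) * P := by rw [hPQ, Matrix.mul_one]; simp only [Matrix.mul_assoc]
  rw [h, h, Matrix.mul_sub, Matrix.sub_mul]

omit [Fintype m'] [DecidableEq κ] in
/-- `QYP = 0 ⟹ Y = 0` when `PQ = 1`. [folklore] -/
private theorem eq_zero_of_conj_eq_zero₁₃₁ {P : Matrix m κ R} {Q : Matrix κ m R} (hPQ : P * Q = 1) {Y : Matrix m m R}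
    (h : Q * Y * P = 0) : Y = 0 := by
  calc Y = P * Q * Y * (P * Q) := by rw [hPQ, Matrix.one_mul, Matrix.mul_one]
    _ = P * (Q * Y * P) * Q := by simp only [Matrix.mul_assoc]
    _ = 0 := by rw [h, Matrix.mul_zero, Matrix.zero_mul]

omit [Fintype m'] in
/-- Transport of skewness: `ᵗXG + GX = 0 ⟹ ᵗ(QXP)(ᵗPGP) + (ᵗPGP)(QXP) = 0` when `PQ = 1`.
[cite: McDuffSalamon2017, §2.2 (2.2.1)–(2.2.2) (change of symplectic basis)] -/
private theorem conj_skew₁₃₁ {K : Type*} [Field K] {P : Matrix m κ K} {Q : Matrix κ m K} (hPQ : P * Q = 1)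
    {G X : Matrix m m K} (hX : Xᵀ * G + G * X = 0) :
    (Q * X * P)ᵀ * (Pᵀ * G * P) + Pᵀ * G * P * (Q * X * P) = 0 :=
  mem_skewAdjointMatricesSubmodule_iff_transpose_mul_add_mul_eq_zero.1
    (conj_mem_skewAdjointMatricesSubmodule hPQ (mem_skewAdjointMatricesSubmodule_iff_transpose_mul_add_mul_eq_zero.2 hX))

omit [Fintype κ] [DecidableEq m] [DecidableEq κ] in
/-- `[(A₁ 0; 0 A₂), (B₁ 0; 0 B₂)] = ([A₁,B₁] 0; 0 [A₂,B₂])`, read off on the diagonal blocks. [folklore] -/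
private theorem toBlocks_diag_bracket₁₃₁ {A B : Matrix (m ⊕ m') (m ⊕ m') R} {A₁ B₁ : Matrix m m R} {A₂ B₂ : Matrix m' m' R}
    (hA : A = fromBlocks A₁ 0 0 A₂) (hB : B = fromBlocks B₁ 0 0 B₂) :
    (A * B - B * A).toBlocks₁₁ = A₁ * B₁ - B₁ * A₁ ∧ (A * B - B * A).toBlocks₂₂ = A₂ * B₂ - B₂ * A₂ := by
  have h : A * B - B * A = fromBlocks (A₁ * B₁ - B₁ * A₁) 0 0 (A₂ * B₂ - B₂ * A₂) := by
    rw [hA, hB, Matrix.fromBlocks_multiply, Matrix.fromBlocks_multiply, sub_eq_add_neg, Matrix.fromBlocks_neg,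
      Matrix.fromBlocks_add]
    simp [sub_eq_add_neg]
  rw [h, Matrix.toBlocks_fromBlocks₁₁, Matrix.toBlocks_fromBlocks₂₂]
  exact ⟨rfl, rfl⟩

omit [Fintype κ] [DecidableEq m] [DecidableEq κ] in
/-- `A₂ T = T A₁ ⟹ (A₁ 0; 0 A₂)` commutes with `(0 0; T 0)`. [folklore] -/
private theorem fromBlocks_diag_comm_lowerLeft₁₃₁ {A₁ : Matrix m m R} {A₂ : Matrix m' m' R} {T : Matrix m' m R}
    (h : A₂ * T = T * A₁) :
    fromBlocks A₁ 0 0 A₂ * fromBlocks 0 0 T 0 = fromBlocks 0 0 T 0 * fromBlocks A₁ 0 0 A₂ := by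
  rw [Matrix.fromBlocks_multiply, Matrix.fromBlocks_multiply]
  simp [h]

omit [Fintype κ] [DecidableEq m] [DecidableEq κ] in
/-- `A₁ T = T A₂ ⟹ (A₁ 0; 0 A₂)` commutes with `(0 T; 0 0)`. [folklore] -/
private theorem fromBlocks_diag_comm_upperRight₁₃₁ {A₁ : Matrix m m R} {A₂ : Matrix m' m' R} {T : Matrix m m' R}
    (h : A₁ * T = T * A₂) :
    fromBlocks A₁ 0 0 A₂ * fromBlocks 0 T 0 0 = fromBlocks 0 T 0 0 * fromBlocks A₁ 0 0 A₂ := by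
  rw [Matrix.fromBlocks_multiply, Matrix.fromBlocks_multiply]
  simp [h]

/-- `J₀ ⊗ 1 = J₀` over `ℂ`. [folklore] -/
private theorem map_J₁₃₁ (l : Type*) [DecidableEq l] : (Matrix.J l ℝ).map Complex.ofRealHom = Matrix.J l ℂ := by
  ext i j
  rcases i with i | i <;> rcases j with j | j <;> simp [Matrix.J, Matrix.one_apply, apply_ite Complex.ofReal]

end Helpers

/-! ### §0' Torus helpers (file-local) -/

section TorusHelpers

variable {ι : Type*} [Fintype ι] [DecidableEq ι] {E : Type*} [NormedAddCommGroup E] [NormedSpace ℂ E]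
  [FiniteDimensional ℂ E] (Φ : (ι → ℝ) ≃L[ℝ] E) {η : E [⋀^Fin 2]→L[ℝ] ℝ}

include Φ in
omit [DecidableEq ι] in
/-- A two-dimensional complex torus has a non-empty lattice index type. [cite: Lange2023AbelianVarietiesComplex, §1.1.1] -/
private theorem nonempty_of_finrank_eq_two₁₃₁ (h2 : finrank ℂ E = 2) : Nonempty ι := by
  have hc := card_eq_two_mul_finrank Φ
  exact Fintype.card_pos_iff.1 (by omega)

variable {Φ} in
/-- COMPLEX SYMPLECTIC COORDINATES: invertible `P ∈ M_{ι × 2g}(ℂ)`, `Q` (real, complexified) with `Q (J ⊗ 1) P = -J₀` and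
`ᵗP (G ⊗ 1) P = -J₀` (`G` the Gram matrix of the polarisation). [cite: Lange2023AbelianVarietiesComplex, §7.3.2 Lemma 7.3.7 (p. 338)] -/
private theorem IsRiemannForm.exists_conj_map_jMatrix_latticeGram_eq₁₃₁ (hη : IsRiemannForm Φ η) :
    ∃ (P : Matrix ι (Fin (finrank ℂ E) ⊕ Fin (finrank ℂ E)) ℂ) (Q : Matrix (Fin (finrank ℂ E) ⊕ Fin (finrank ℂ E)) ι ℂ),
      Q * P = 1 ∧ P * Q = 1 ∧ Q * (jMatrix Φ).map Complex.ofRealHom * P = -Matrix.J (Fin (finrank ℂ E)) ℂ ∧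
        Pᵀ * (latticeGram Φ η).map Complex.ofRealHom * P = -Matrix.J (Fin (finrank ℂ E)) ℂ := by
  obtain ⟨P, Q, hQP, hPQ, hJ, hG⟩ := hη.exists_conj_jMatrix_latticeGram_eq
  refine ⟨P.map Complex.ofRealHom, Q.map Complex.ofRealHom, ?_, ?_, ?_, ?_⟩
  · rw [← Matrix.map_mul, hQP, Matrix.map_one _ (map_zero _) (map_one _)]
  · rw [← Matrix.map_mul, hPQ, Matrix.map_one _ (map_zero _) (map_one _)]
  · rw [← Matrix.map_mul, ← Matrix.map_mul, hJ, Matrix.map_neg _ (map_neg Complex.ofRealHom), map_J₁₃₁]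
  · rw [← Matrix.transpose_map, ← Matrix.map_mul, ← Matrix.map_mul, hG, Matrix.map_neg _ (map_neg Complex.ofRealHom),
      map_J₁₃₁]

end TorusHelpers

/-! ## §1 The graph case forces an isogeny: `Hg(S₁ × S₂) ≠ Hg(S₁) × Hg(S₂) ⟹ Hom_ℚ(S₁, S₂) ≠ 0 ⟹ S₁ ∼ S₂` -/

section Core

variable {ι₁ ι₂ : Type*} [Fintype ι₁] [DecidableEq ι₁] [Fintype ι₂] [DecidableEq ι₂]
  {E₁ E₂ : Type*} [NormedAddCommGroup E₁] [NormedSpace ℂ E₁] [FiniteDimensional ℂ E₁] [NormedAddCommGroup E₂]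
  [NormedSpace ℂ E₂] [FiniteDimensional ℂ E₂] {Φ₁ : (ι₁ → ℝ) ≃L[ℝ] E₁} {Φ₂ : (ι₂ → ℝ) ≃L[ℝ] E₂}
  {η₁ : E₁ [⋀^Fin 2]→L[ℝ] ℝ} {η₂ : E₂ [⋀^Fin 2]→L[ℝ] ℝ}

/-- **MOONEN–ZARHIN LEMMA (3.3)∕(3.4) FOR TWO TYPE I(1) SURFACES.**  `S₁`, `S₂` polarised complex abelian surfaces with
`End_ℚ(S₁) = ℚ = End_ℚ(S₂)` and `Hg(S₁ × S₂)(ℂ) ≠ Hg(S₁)(ℂ) × Hg(S₂)(ℂ)` ⟹ `Hom_ℚ(S₁, S₂) ≠ 0` and `Hom_ℚ(S₂, S₁) ≠ 0`: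
`Lie Hg(S₁ × S₂)(ℂ) = Γ_φ` is the graph of `φ : 𝔰𝔭(V₁)_ℂ ⥲ 𝔰𝔭(V₂)_ℂ` through `(J₁, J₂)` («`Γ_{φ,ℂ} ∋ J_{X×Y} = (J_X, J_Y)`»), so by the
graph lemma for `𝔰𝔭₄` (`Sp4Graph.exists_intertwiner_of_graph₂`) `φ = Ad(g)`, and `(0 0; P₂gQ₁ 0) ∈ End(V_ℂ)^{𝔤} = End_ℚ(S₁ × S₂) ⊗ ℂ`
has a non-zero `Hom_ℚ(S₁, S₂)`-block («some multiple of `φ` corresponds to an isogeny»).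
[cite: MoonenZarhin1999LowDim, §3 (3.1) (p0006 L25–L51), proof of Lemma (3.3) (p0006 L126–L129), Lemma (3.4) (p0006 L133–L138)]
[cite: Lange2023AbelianVarietiesComplex, §7.2.4 Exercise (3) and §7.3.2 Lemma 7.3.7] [cite: Jacobson1962LieAlgebras, Ch. IX §5 Thms. 5–6] -/
theorem IsRiemannForm.homRat_ne_bot_of_hodgeGroupC_prod_ne_blockDiagProd_of_finrank_eq_two
    (hη₁ : IsRiemannForm Φ₁ η₁) (hη₂ : IsRiemannForm Φ₂ η₂) (h2₁ : finrank ℂ E₁ = 2) (h2₂ : finrank ℂ E₂ = 2)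
    (hE₁ : endAlgRat Φ₁ = ⊥) (hE₂ : endAlgRat Φ₂ = ⊥)
    (hne : hodgeGroupC (prodPeriod Φ₁ Φ₂) ≠ blockDiagProd (hodgeGroupC Φ₁) (hodgeGroupC Φ₂)) :
    homRat Φ₁ Φ₂ ≠ ⊥ ∧ homRat Φ₂ Φ₁ ≠ ⊥ := by
  classical
  haveI : Nonempty ι₁ := nonempty_of_finrank_eq_two₁₃₁ Φ₁ h2₁
  haveI : Nonempty ι₂ := nonempty_of_finrank_eq_two₁₃₁ Φ₂ h2₂
  -- both `Lie Hg(Sᵢ)(ℂ) = 𝔰𝔭₄(ℂ)` are simple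
  have hs₁ := hη₁.isSimple_lieSubalgebraGL_map_toGL_hodgeGroupC_of_hodgeGroup_eq_spGroup' Φ₁
    (hη₁.hodgeGroup_eq_spGroup_of_finrank_eq_two_of_endAlgRat_eq_bot h2₁ hE₁)
  have hs₂ := hη₂.isSimple_lieSubalgebraGL_map_toGL_hodgeGroupC_of_hodgeGroup_eq_spGroup' Φ₂
    (hη₂.hodgeGroup_eq_spGroup_of_finrank_eq_two_of_endAlgRat_eq_bot h2₂ hE₂)
  -- the graph case: both kernels `Lie Kᵢ` vanish
  have hK₁ : lieAlgebraGL ((hodgeGroupCProdInl Φ₁ Φ₂).map Matrix.SpecialLinearGroup.toGL) = ⊥ := by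
    rcases identityComponent_hodgeGroupCProdInl_eq_bot_or_eq_of_almostSimple Φ₁ Φ₂
        (almostSimple_map_toGL_hodgeGroupC_of_isSimple_lieSubalgebraGL Φ₁ hs₁) with h | h
    · rw [← lieAlgebraGL_identityComponent (isAlgebraicSubgroup_map_toGL_hodgeGroupCProdInl Φ₁ Φ₂), h, lieAlgebraGL_bot]
    · exact absurd (hodgeGroupC_prod_eq_blockDiagProd_of_hodgeGroupCProdInl_eq Φ₁ Φ₂ h) hne
  have hK₂ : lieAlgebraGL ((hodgeGroupCProdInr Φ₁ Φ₂).map Matrix.SpecialLinearGroup.toGL) = ⊥ := by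
    rcases identityComponent_hodgeGroupCProdInr_eq_bot_or_eq_of_almostSimple Φ₁ Φ₂
        (almostSimple_map_toGL_hodgeGroupC_of_isSimple_lieSubalgebraGL Φ₂ hs₂) with h | h
    · rw [← lieAlgebraGL_identityComponent (isAlgebraicSubgroup_map_toGL_hodgeGroupCProdInr Φ₁ Φ₂), h, lieAlgebraGL_bot]
    · exact absurd (hodgeGroupC_prod_eq_blockDiagProd_of_hodgeGroupCProdInr_eq Φ₁ Φ₂ h) hne
  -- complex symplectic coordinates on both factors
  obtain ⟨P₁, Q₁, hQP₁, hPQ₁, hJ₁, hG₁⟩ := hη₁.exists_conj_map_jMatrix_latticeGram_eq₁₃₁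
  obtain ⟨P₂, Q₂, hQP₂, hPQ₂, hJ₂, hG₂⟩ := hη₂.exists_conj_map_jMatrix_latticeGram_eq₁₃₁
  -- the two block projections, read in symplectic coordinates
  set G := lieAlgebraGL ((hodgeGroupC (prodPeriod Φ₁ Φ₂)).map Matrix.SpecialLinearGroup.toGL) with hGdef
  set r₁ : Matrix (ι₁ ⊕ ι₂) (ι₁ ⊕ ι₂) ℂ →ₗ[ℂ]
      Matrix (Fin (finrank ℂ E₁) ⊕ Fin (finrank ℂ E₁)) (Fin (finrank ℂ E₁) ⊕ Fin (finrank ℂ E₁)) ℂ :=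
    { toFun := fun Z ↦ Q₁ * Z.toBlocks₁₁ * P₁
      map_add' := fun Z W ↦ by
        change Q₁ * (Z.toBlocks₁₁ + W.toBlocks₁₁) * P₁ = _
        rw [Matrix.mul_add, Matrix.add_mul]
      map_smul' := fun c Z ↦ by
        change Q₁ * (c • Z.toBlocks₁₁) * P₁ = c • (Q₁ * Z.toBlocks₁₁ * P₁)
        rw [Matrix.mul_smul, Matrix.smul_mul] } with hr₁def
  set r₂ : Matrix (ι₁ ⊕ ι₂) (ι₁ ⊕ ι₂) ℂ →ₗ[ℂ]
      Matrix (Fin (finrank ℂ E₂) ⊕ Fin (finrank ℂ E₂)) (Fin (finrank ℂ E₂) ⊕ Fin (finrank ℂ E₂)) ℂ :=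
    { toFun := fun Z ↦ Q₂ * Z.toBlocks₂₂ * P₂
      map_add' := fun Z W ↦ by
        change Q₂ * (Z.toBlocks₂₂ + W.toBlocks₂₂) * P₂ = _
        rw [Matrix.mul_add, Matrix.add_mul]
      map_smul' := fun c Z ↦ by
        change Q₂ * (c • Z.toBlocks₂₂) * P₂ = c • (Q₂ * Z.toBlocks₂₂ * P₂)
        rw [Matrix.mul_smul, Matrix.smul_mul] } with hr₂def
  have hr₁ : ∀ Z, r₁ Z = Q₁ * Z.toBlocks₁₁ * P₁ := fun Z ↦ rfl
  have hr₂ : ∀ Z, r₂ Z = Q₂ * Z.toBlocks₂₂ * P₂ := fun Z ↦ rfl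
  -- (i) brackets lift
  have hbr : ∀ A ∈ G, ∀ B ∈ G, ∃ C ∈ G,
      r₁ C = r₁ A * r₁ B - r₁ B * r₁ A ∧ r₂ C = r₂ A * r₂ B - r₂ B * r₂ A := by
    intro A hA B hB
    obtain ⟨hAeq, -, -⟩ := eq_fromBlocks_of_mem_lieAlgebraGL_hodgeGroupC_prod Φ₁ Φ₂ hA
    obtain ⟨hBeq, -, -⟩ := eq_fromBlocks_of_mem_lieAlgebraGL_hodgeGroupC_prod Φ₁ Φ₂ hB
    obtain ⟨h₁₁, h₂₂⟩ := toBlocks_diag_bracket₁₃₁ hAeq hBeq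
    exact ⟨A * B - B * A, lie_mem_lieAlgebraGL hA hB, by rw [hr₁, hr₁, hr₁, h₁₁, conj_mul_sub_mul₁₃₁ hPQ₁],
      by rw [hr₂, hr₂, hr₂, h₂₂, conj_mul_sub_mul₁₃₁ hPQ₂]⟩
  -- (ii) both projections land in `𝔰𝔭(J₀)`
  have h₁ : ∀ A ∈ G, (r₁ A)ᵀ * Matrix.J (Fin (finrank ℂ E₁)) ℂ + Matrix.J (Fin (finrank ℂ E₁)) ℂ * r₁ A = 0 := by
    intro A hA
    obtain ⟨-, hA₁, -⟩ := eq_fromBlocks_of_mem_lieAlgebraGL_hodgeGroupC_prod Φ₁ Φ₂ hA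
    have h := conj_skew₁₃₁ hPQ₁ (hη₁.transpose_mul_map_latticeGram_add_eq_zero_of_mem_hodgeGroupLieC
      ((mem_hodgeGroupLieC_iff_mem_lieAlgebraGL Φ₁).2 hA₁))
    rw [hG₁, Matrix.mul_neg, Matrix.neg_mul, ← neg_add, neg_eq_zero] at h
    rw [hr₁]
    exact h
  have h₂ : ∀ A ∈ G, (r₂ A)ᵀ * Matrix.J (Fin (finrank ℂ E₂)) ℂ + Matrix.J (Fin (finrank ℂ E₂)) ℂ * r₂ A = 0 := by
    intro A hA
    obtain ⟨-, -, hA₂⟩ := eq_fromBlocks_of_mem_lieAlgebraGL_hodgeGroupC_prod Φ₁ Φ₂ hA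
    have h := conj_skew₁₃₁ hPQ₂ (hη₂.transpose_mul_map_latticeGram_add_eq_zero_of_mem_hodgeGroupLieC
      ((mem_hodgeGroupLieC_iff_mem_lieAlgebraGL Φ₂).2 hA₂))
    rw [hG₂, Matrix.mul_neg, Matrix.neg_mul, ← neg_add, neg_eq_zero] at h
    rw [hr₂]
    exact h
  -- (iii) the first projection is ONTO `𝔰𝔭(J₀)` (`Hg(S₁) = Sp(V₁, E₁)` and `r₁` is surjective)
  obtain ⟨f, g, hf, hg, hfs, -, -⟩ := exists_lieHom_toBlocks Φ₁ Φ₂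
  have hs : ∀ X : Matrix (Fin (finrank ℂ E₁) ⊕ Fin (finrank ℂ E₁)) (Fin (finrank ℂ E₁) ⊕ Fin (finrank ℂ E₁)) ℂ,
      Xᵀ * Matrix.J (Fin (finrank ℂ E₁)) ℂ + Matrix.J (Fin (finrank ℂ E₁)) ℂ * X = 0 → ∃ A ∈ G, r₁ A = X := by
    intro X hX
    have hX' : Xᵀ * (-Matrix.J (Fin (finrank ℂ E₁)) ℂ) + -Matrix.J (Fin (finrank ℂ E₁)) ℂ * X = 0 := by
      rw [Matrix.mul_neg, Matrix.neg_mul, ← neg_add, hX, neg_zero]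
    have hY := conj_skew₁₃₁ hQP₁ hX'
    have hGQ : Q₁ᵀ * (-Matrix.J (Fin (finrank ℂ E₁)) ℂ) * Q₁ = (latticeGram Φ₁ η₁).map Complex.ofRealHom := by
      rw [← hG₁]
      calc Q₁ᵀ * (P₁ᵀ * (latticeGram Φ₁ η₁).map Complex.ofRealHom * P₁) * Q₁
          = (P₁ * Q₁)ᵀ * (latticeGram Φ₁ η₁).map Complex.ofRealHom * (P₁ * Q₁) := by
            rw [Matrix.transpose_mul]; simp only [Matrix.mul_assoc]
        _ = (latticeGram Φ₁ η₁).map Complex.ofRealHom := by rw [hPQ₁, Matrix.transpose_one, Matrix.one_mul, Matrix.mul_one]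
    rw [hGQ] at hY
    have hYmem : P₁ * X * Q₁ ∈ lieAlgebraGL ((hodgeGroupC Φ₁).map Matrix.SpecialLinearGroup.toGL) :=
      (mem_hodgeGroupLieC_iff_mem_lieAlgebraGL Φ₁).1
        (hη₁.mem_hodgeGroupLieC_of_transpose_mul_add_eq_zero_of_finrank_eq_two h2₁ hE₁ hY)
    obtain ⟨Z, hZ⟩ := hfs ⟨P₁ * X * Q₁, hYmem⟩
    have hZ₁ : (Z : Matrix (ι₁ ⊕ ι₂) (ι₁ ⊕ ι₂) ℂ).toBlocks₁₁ = P₁ * X * Q₁ := by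
      rw [← hf Z, hZ]
    refine ⟨(Z : Matrix (ι₁ ⊕ ι₂) (ι₁ ⊕ ι₂) ℂ), Z.2, ?_⟩
    rw [hr₁, hZ₁]
    calc Q₁ * (P₁ * X * Q₁) * P₁ = Q₁ * P₁ * X * (Q₁ * P₁) := by simp only [Matrix.mul_assoc]
      _ = X := by rw [hQP₁, Matrix.one_mul, Matrix.mul_one]
  -- (iv) the kernels are coupled (both are `0`)
  have hker : ∀ A ∈ G, r₁ A = 0 ↔ r₂ A = 0 := by
    intro A hA
    rw [hr₁, hr₂]
    constructor
    · intro h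
      have h₁₁ : A.toBlocks₁₁ = 0 := eq_zero_of_conj_eq_zero₁₃₁ hPQ₁ h
      have h₂₂ := toBlocks₂₂_mem_lieAlgebraGL_hodgeGroupCProdInr Φ₁ Φ₂ hA h₁₁
      rw [hK₂, Submodule.mem_bot] at h₂₂
      rw [h₂₂, Matrix.mul_zero, Matrix.zero_mul]
    · intro h
      have h₂₂ : A.toBlocks₂₂ = 0 := eq_zero_of_conj_eq_zero₁₃₁ hPQ₂ h
      have h₁₁ := toBlocks₁₁_mem_lieAlgebraGL_hodgeGroupCProdInl Φ₁ Φ₂ hA h₂₂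
      rw [hK₁, Submodule.mem_bot] at h₁₁
      rw [h₁₁, Matrix.mul_zero, Matrix.zero_mul]
  -- (v) `(J₁, J₂)` is attained: `-(J ⊗ 1) ∈ Lie Hg(S₁ × S₂)(ℂ)` maps to `(J₀, J₀)`
  have hJ : ∃ A ∈ G, r₁ A = Matrix.J (Fin (finrank ℂ E₁)) ℂ ∧ r₂ A = Matrix.J (Fin (finrank ℂ E₂)) ℂ := by
    have hmem : (jMatrix (prodPeriod Φ₁ Φ₂)).map Complex.ofRealHom ∈ G :=
      (mem_hodgeGroupLieC_iff_mem_lieAlgebraGL (prodPeriod Φ₁ Φ₂)).1 (jMatrix_map_mem_hodgeGroupLieC (prodPeriod Φ₁ Φ₂))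
    have hbl : (jMatrix (prodPeriod Φ₁ Φ₂)).map Complex.ofRealHom =
        fromBlocks ((jMatrix Φ₁).map Complex.ofRealHom) 0 0 ((jMatrix Φ₂).map Complex.ofRealHom) := by
      rw [jMatrix_prodPeriod, Matrix.fromBlocks_map, Matrix.map_zero _ (map_zero _), Matrix.map_zero _ (map_zero _)]
    refine ⟨-(jMatrix (prodPeriod Φ₁ Φ₂)).map Complex.ofRealHom, G.neg_mem hmem, ?_, ?_⟩
    · rw [map_neg, hr₁, hbl, Matrix.toBlocks_fromBlocks₁₁, hJ₁, neg_neg]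
    · rw [map_neg, hr₂, hbl, Matrix.toBlocks_fromBlocks₂₂, hJ₂, neg_neg]
  -- THE GRAPH LEMMA: `φ = Ad(g)`
  obtain ⟨g, g', hgg', hg'g, hint⟩ :=
    Sp4Graph.exists_intertwiner_of_graph₂ (finCongr h2₁) (finCongr h2₂) Complex.I_mul_I hbr h₁ h₂ hs hker hJ
  have hint' : ∀ A ∈ G, r₁ A * g' = g' * r₂ A := fun A hA ↦ by
    calc r₁ A * g' = g' * g * r₁ A * g' := by rw [hg'g, Matrix.one_mul]
      _ = g' * (r₂ A * g) * g' := by rw [Matrix.mul_assoc g' g, ← hint A hA]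
      _ = g' * r₂ A := by rw [Matrix.mul_assoc, Matrix.mul_assoc, hgg', Matrix.mul_one]
  -- the intertwiners `T : V₁,ℂ → V₂,ℂ`, `T' : V₂,ℂ → V₁,ℂ`
  have hT : ∀ Z ∈ G, Z.toBlocks₂₂ * (P₂ * g * Q₁) = P₂ * g * Q₁ * Z.toBlocks₁₁ := fun Z hZ ↦ by
    calc Z.toBlocks₂₂ * (P₂ * g * Q₁) = P₂ * Q₂ * Z.toBlocks₂₂ * (P₂ * g * Q₁) := by rw [hPQ₂, Matrix.one_mul]
      _ = P₂ * (Q₂ * Z.toBlocks₂₂ * P₂ * g) * Q₁ := by simp only [Matrix.mul_assoc]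
      _ = P₂ * (g * (Q₁ * Z.toBlocks₁₁ * P₁)) * Q₁ := by rw [← hr₁, ← hr₂, hint Z hZ]
      _ = P₂ * g * Q₁ * Z.toBlocks₁₁ * (P₁ * Q₁) := by simp only [Matrix.mul_assoc]
      _ = P₂ * g * Q₁ * Z.toBlocks₁₁ := by rw [hPQ₁, Matrix.mul_one]
  have hT' : ∀ Z ∈ G, Z.toBlocks₁₁ * (P₁ * g' * Q₂) = P₁ * g' * Q₂ * Z.toBlocks₂₂ := fun Z hZ ↦ by
    calc Z.toBlocks₁₁ * (P₁ * g' * Q₂) = P₁ * Q₁ * Z.toBlocks₁₁ * (P₁ * g' * Q₂) := by rw [hPQ₁, Matrix.one_mul]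
      _ = P₁ * (Q₁ * Z.toBlocks₁₁ * P₁ * g') * Q₂ := by simp only [Matrix.mul_assoc]
      _ = P₁ * (g' * (Q₂ * Z.toBlocks₂₂ * P₂)) * Q₂ := by rw [← hr₁, ← hr₂, hint' Z hZ]
      _ = P₁ * g' * Q₂ * Z.toBlocks₂₂ * (P₂ * Q₂) := by simp only [Matrix.mul_assoc]
      _ = P₁ * g' * Q₂ * Z.toBlocks₂₂ := by rw [hPQ₂, Matrix.mul_one]
  -- they are non-zero (`g`, `g'` are invertible and `V₂ ≠ 0`)
  have h10 : ∀ {n : ℕ}, n = 2 → (1 : Matrix (Fin n ⊕ Fin n) (Fin n ⊕ Fin n) ℂ) ≠ 0 := by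
    rintro n rfl h
    have h' := congrFun (congrFun h (Sum.inl 0)) (Sum.inl 0)
    rw [Matrix.one_apply_eq, Matrix.zero_apply] at h'
    exact one_ne_zero h'
  have hT0 : P₂ * g * Q₁ ≠ 0 := by
    intro h
    have hg0 : g = 0 := by
      calc g = Q₂ * P₂ * g * (Q₁ * P₁) := by rw [hQP₂, hQP₁, Matrix.one_mul, Matrix.mul_one]
        _ = Q₂ * (P₂ * g * Q₁) * P₁ := by simp only [Matrix.mul_assoc]
        _ = 0 := by rw [h, Matrix.mul_zero, Matrix.zero_mul]
    rw [hg0, Matrix.zero_mul] at hgg'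
    exact h10 h2₂ hgg'.symm
  have hT0' : P₁ * g' * Q₂ ≠ 0 := by
    intro h
    have hg0 : g' = 0 := by
      calc g' = Q₁ * P₁ * g' * (Q₂ * P₂) := by rw [hQP₁, hQP₂, Matrix.one_mul, Matrix.mul_one]
        _ = Q₁ * (P₁ * g' * Q₂) * P₂ := by simp only [Matrix.mul_assoc]
        _ = 0 := by rw [h, Matrix.mul_zero, Matrix.zero_mul]
    rw [hg0, Matrix.zero_mul] at hg'g
    exact h10 h2₁ hg'g.symm
  -- `(0 0; T 0)` and `(0 T'; 0 0)` commute with `𝔤`, hence lie in `End_ℚ(S₁ × S₂) ⊗ ℂ`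
  have hYspan := (forall_hodgeGroupComplexLie_comm_iff_mem_span_endAlgRat (prodPeriod Φ₁ Φ₂)).1 (fun Z hZ ↦ by
    have hZ' : Z ∈ G := (mem_hodgeGroupComplexLie_iff_mem_lieAlgebraGL (prodPeriod Φ₁ Φ₂)).1 hZ
    obtain ⟨hZeq, -, -⟩ := eq_fromBlocks_of_mem_lieAlgebraGL_hodgeGroupC_prod Φ₁ Φ₂ hZ'
    change Z * fromBlocks 0 0 (P₂ * g * Q₁) 0 = fromBlocks 0 0 (P₂ * g * Q₁) 0 * Z
    rw [hZeq]
    exact fromBlocks_diag_comm_lowerLeft₁₃₁ (hT Z hZ'))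
  have hY'span := (forall_hodgeGroupComplexLie_comm_iff_mem_span_endAlgRat (prodPeriod Φ₁ Φ₂)).1 (fun Z hZ ↦ by
    have hZ' : Z ∈ G := (mem_hodgeGroupComplexLie_iff_mem_lieAlgebraGL (prodPeriod Φ₁ Φ₂)).1 hZ
    obtain ⟨hZeq, -, -⟩ := eq_fromBlocks_of_mem_lieAlgebraGL_hodgeGroupC_prod Φ₁ Φ₂ hZ'
    change Z * fromBlocks 0 (P₁ * g' * Q₂) 0 0 = fromBlocks 0 (P₁ * g' * Q₂) 0 0 * Z
    rw [hZeq]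
    exact fromBlocks_diag_comm_upperRight₁₃₁ (hT' Z hZ'))
  -- the off-diagonal blocks of `End_ℚ(S₁ × S₂) ⊗ ℂ` are spanned by `Hom_ℚ`
  have hblocks : ∀ W ∈ Submodule.span ℂ ((fun A : Matrix (ι₁ ⊕ ι₂) (ι₁ ⊕ ι₂) ℚ ↦ A.map ((↑) : ℚ → ℂ)) ''
      (endAlgRat (prodPeriod Φ₁ Φ₂) : Set (Matrix (ι₁ ⊕ ι₂) (ι₁ ⊕ ι₂) ℚ))),
      (homRat Φ₁ Φ₂ = ⊥ → W.toBlocks₂₁ = 0) ∧ (homRat Φ₂ Φ₁ = ⊥ → W.toBlocks₁₂ = 0) := by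
    intro W hW
    induction hW using Submodule.span_induction with
    | mem x hx =>
      obtain ⟨A, hA, rfl⟩ := hx
      obtain ⟨-, h₁₂, h₂₁, -⟩ := (mem_endAlgRat_prod_iff Φ₁ Φ₂ A).1 hA
      refine ⟨fun h0 ↦ ?_, fun h0 ↦ ?_⟩
      · rw [h0, Submodule.mem_bot] at h₂₁
        change A.toBlocks₂₁.map ((↑) : ℚ → ℂ) = 0
        rw [h₂₁, Matrix.map_zero _ Rat.cast_zero]
      · rw [h0, Submodule.mem_bot] at h₁₂
        change A.toBlocks₁₂.map ((↑) : ℚ → ℂ) = 0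
        rw [h₁₂, Matrix.map_zero _ Rat.cast_zero]
    | zero => exact ⟨fun _ ↦ rfl, fun _ ↦ rfl⟩
    | add x y _ _ hx hy =>
      refine ⟨fun h0 ↦ ?_, fun h0 ↦ ?_⟩
      · change x.toBlocks₂₁ + y.toBlocks₂₁ = 0
        rw [hx.1 h0, hy.1 h0, add_zero]
      · change x.toBlocks₁₂ + y.toBlocks₁₂ = 0
        rw [hx.2 h0, hy.2 h0, add_zero]
    | smul a x _ hx =>
      refine ⟨fun h0 ↦ ?_, fun h0 ↦ ?_⟩
      · change a • x.toBlocks₂₁ = 0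
        rw [hx.1 h0, smul_zero]
      · change a • x.toBlocks₁₂ = 0
        rw [hx.2 h0, smul_zero]
  refine ⟨fun h0 ↦ hT0 ?_, fun h0 ↦ hT0' ?_⟩
  · have h := (hblocks _ hYspan).1 h0
    rwa [Matrix.toBlocks_fromBlocks₂₁] at h
  · have h := (hblocks _ hY'span).2 h0
    rwa [Matrix.toBlocks_fromBlocks₁₂] at h

/-- **`S₁`, `S₂` polarised abelian surfaces with `End_ℚ(Sᵢ) = ℚ` and `Hg(S₁ × S₂)(ℂ) ≠ Hg(S₁)(ℂ) × Hg(S₂)(ℂ) ⟹ `S₁ ∼ S₂`**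
(two SIMPLE surfaces with `Hom_ℚ(S₁, S₂) ≠ 0` are isogenous). [cite: MoonenZarhin1999LowDim, §3 Lemma (3.3)–(3.4) (p0006 L126–L138)]
[cite: Lange2023AbelianVarietiesComplex, §2.4.4 Cor. 2.4.26 (proof)] -/
theorem IsRiemannForm.isIsogenous_of_hodgeGroupC_prod_ne_blockDiagProd_of_finrank_eq_two
    (hη₁ : IsRiemannForm Φ₁ η₁) (hη₂ : IsRiemannForm Φ₂ η₂) (h2₁ : finrank ℂ E₁ = 2) (h2₂ : finrank ℂ E₂ = 2)
    (hE₁ : endAlgRat Φ₁ = ⊥) (hE₂ : endAlgRat Φ₂ = ⊥)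
    (hne : hodgeGroupC (prodPeriod Φ₁ Φ₂) ≠ blockDiagProd (hodgeGroupC Φ₁) (hodgeGroupC Φ₂)) : IsIsogenous Φ₁ Φ₂ := by
  by_contra hni
  exact (hη₁.homRat_ne_bot_of_hodgeGroupC_prod_ne_blockDiagProd_of_finrank_eq_two hη₂ h2₁ h2₂ hE₁ hE₂ hne).1
    ((hη₁.isSimple_of_endAlgRat_eq_bot hE₁).homRat_eq_bot (hη₂.isSimple_of_endAlgRat_eq_bot hE₂) hni)

/-- **MOONEN–ZARHIN FOR TWO TYPE I(1) SURFACES: `Hg(S₁ × S₂)(ℂ) = Hg(S₁)(ℂ) × Hg(S₂)(ℂ)` OR `S₁ ∼ S₂`.**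
[cite: MoonenZarhin1999LowDim, §3 Lemma (3.3)–(3.4) and §5 (5.5) (p0009 L93–L100)] -/
theorem IsRiemannForm.hodgeGroupC_prod_eq_blockDiagProd_or_isIsogenous_of_finrank_eq_two_of_endAlgRat_eq_bot
    (hη₁ : IsRiemannForm Φ₁ η₁) (hη₂ : IsRiemannForm Φ₂ η₂) (h2₁ : finrank ℂ E₁ = 2) (h2₂ : finrank ℂ E₂ = 2)
    (hE₁ : endAlgRat Φ₁ = ⊥) (hE₂ : endAlgRat Φ₂ = ⊥) :
    hodgeGroupC (prodPeriod Φ₁ Φ₂) = blockDiagProd (hodgeGroupC Φ₁) (hodgeGroupC Φ₂) ∨ IsIsogenous Φ₁ Φ₂ :=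
  or_iff_not_imp_left.2 fun hne ↦
    hη₁.isIsogenous_of_hodgeGroupC_prod_ne_blockDiagProd_of_finrank_eq_two hη₂ h2₁ h2₂ hE₁ hE₂ hne

/-- **`S₁ ≁ S₂`, `End_ℚ(Sᵢ) = ℚ` ⟹ `Hg(S₁ × S₂)(ℂ) = Hg(S₁)(ℂ) × Hg(S₂)(ℂ)`** (two non-isogenous Hodge-general abelian surfaces).
[cite: MoonenZarhin1999LowDim, §3 Lemma (3.3)–(3.4) and §5 (5.5)] [cite: Gordon1997, §2.16 Proposition] -/
theorem IsRiemannForm.hodgeGroupC_prod_eq_blockDiagProd_of_finrank_eq_two_of_endAlgRat_eq_bot_of_not_isIsogenous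
    (hη₁ : IsRiemannForm Φ₁ η₁) (hη₂ : IsRiemannForm Φ₂ η₂) (h2₁ : finrank ℂ E₁ = 2) (h2₂ : finrank ℂ E₂ = 2)
    (hE₁ : endAlgRat Φ₁ = ⊥) (hE₂ : endAlgRat Φ₂ = ⊥) (hni : ¬ IsIsogenous Φ₁ Φ₂) :
    hodgeGroupC (prodPeriod Φ₁ Φ₂) = blockDiagProd (hodgeGroupC Φ₁) (hodgeGroupC Φ₂) :=
  (hη₁.hodgeGroupC_prod_eq_blockDiagProd_or_isIsogenous_of_finrank_eq_two_of_endAlgRat_eq_bot hη₂ h2₁ h2₂ hE₁ hE₂).resolve_right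
    hni

/-- Real points: `S₁ ≁ S₂`, `End_ℚ(Sᵢ) = ℚ` ⟹ `Hg(S₁ × S₂) = Hg(S₁) × Hg(S₂)`. [cite: MoonenZarhin1999LowDim, §3 Lemma (3.3)–(3.4) and §5 (5.5)] -/
theorem IsRiemannForm.hodgeGroup_prod_eq_of_finrank_eq_two_of_endAlgRat_eq_bot_of_not_isIsogenous
    (hη₁ : IsRiemannForm Φ₁ η₁) (hη₂ : IsRiemannForm Φ₂ η₂) (h2₁ : finrank ℂ E₁ = 2) (h2₂ : finrank ℂ E₂ = 2)
    (hE₁ : endAlgRat Φ₁ = ⊥) (hE₂ : endAlgRat Φ₂ = ⊥) (hni : ¬ IsIsogenous Φ₁ Φ₂) :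
    hodgeGroup (prodPeriod Φ₁ Φ₂) = ((hodgeGroup Φ₁).prod (hodgeGroup Φ₂)).map (blockDiag ι₁ ι₂) :=
  hodgeGroup_prod_eq_of_hodgeGroupC_prod_eq
    (hη₁.hodgeGroupC_prod_eq_blockDiagProd_of_finrank_eq_two_of_endAlgRat_eq_bot_of_not_isIsogenous hη₂ h2₁ h2₂ hE₁ hE₂ hni)

/-- `IsAbelianVariety` form of the dichotomy: `Hg(S₁ × S₂)(ℂ) = Hg(S₁)(ℂ) × Hg(S₂)(ℂ)` or `S₁ ∼ S₂`.
[cite: MoonenZarhin1999LowDim, §3 Lemma (3.3)–(3.4) and §5 (5.5)] -/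
theorem IsAbelianVariety.hodgeGroupC_prod_eq_blockDiagProd_or_isIsogenous_of_finrank_eq_two_of_endAlgRat_eq_bot
    (hS₁ : IsAbelianVariety Φ₁) (hS₂ : IsAbelianVariety Φ₂) (h2₁ : finrank ℂ E₁ = 2) (h2₂ : finrank ℂ E₂ = 2)
    (hE₁ : endAlgRat Φ₁ = ⊥) (hE₂ : endAlgRat Φ₂ = ⊥) :
    hodgeGroupC (prodPeriod Φ₁ Φ₂) = blockDiagProd (hodgeGroupC Φ₁) (hodgeGroupC Φ₂) ∨ IsIsogenous Φ₁ Φ₂ := by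
  obtain ⟨η₁, hη₁⟩ := hS₁
  obtain ⟨η₂, hη₂⟩ := hS₂
  exact hη₁.hodgeGroupC_prod_eq_blockDiagProd_or_isIsogenous_of_finrank_eq_two_of_endAlgRat_eq_bot hη₂ h2₁ h2₂ hE₁ hE₂

/-- `IsAbelianVariety` form: `S₁ ≁ S₂`, `End_ℚ(Sᵢ) = ℚ` ⟹ `Hg(S₁ × S₂)(ℂ) = Hg(S₁)(ℂ) × Hg(S₂)(ℂ)`.
[cite: MoonenZarhin1999LowDim, §3 Lemma (3.3)–(3.4) and §5 (5.5)] -/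
theorem IsAbelianVariety.hodgeGroupC_prod_eq_blockDiagProd_of_finrank_eq_two_of_endAlgRat_eq_bot_of_not_isIsogenous
    (hS₁ : IsAbelianVariety Φ₁) (hS₂ : IsAbelianVariety Φ₂) (h2₁ : finrank ℂ E₁ = 2) (h2₂ : finrank ℂ E₂ = 2)
    (hE₁ : endAlgRat Φ₁ = ⊥) (hE₂ : endAlgRat Φ₂ = ⊥) (hni : ¬ IsIsogenous Φ₁ Φ₂) :
    hodgeGroupC (prodPeriod Φ₁ Φ₂) = blockDiagProd (hodgeGroupC Φ₁) (hodgeGroupC Φ₂) :=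
  (hS₁.hodgeGroupC_prod_eq_blockDiagProd_or_isIsogenous_of_finrank_eq_two_of_endAlgRat_eq_bot hS₂ h2₁ h2₂ hE₁ hE₂).resolve_right
    hni

end Core

/-! ## §2 Condition (D): `S₁` Hodge-general, `S₂` ANY abelian surface -/

section ConditionD

variable {ι₁ ι₂ : Type} [Fintype ι₁] [DecidableEq ι₁] [Fintype ι₂] [DecidableEq ι₂]
  {E₁ E₂ : Type} [NormedAddCommGroup E₁] [NormedSpace ℂ E₁] [FiniteDimensional ℂ E₁] [NormedAddCommGroup E₂]
  [NormedSpace ℂ E₂] [FiniteDimensional ℂ E₂] {Φ₁ : (ι₁ → ℝ) ≃L[ℝ] E₁} {Φ₂ : (ι₂ → ℝ) ≃L[ℝ] E₂}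
  {η₁ : E₁ [⋀^Fin 2]→L[ℝ] ℝ} {η₂ : E₂ [⋀^Fin 2]→L[ℝ] ℝ}

/-- **`S₁` AN ABELIAN SURFACE WITH `End_ℚ(S₁) = ℚ`, `S₂` ANY ABELIAN SURFACE: every power of `S₁ × S₂` has its Hodge ring generated
by divisor classes** (`End_ℚ(S₂) ≠ ℚ`: g51's dimension route; `End_ℚ(S₂) = ℚ`: `S₂ ∼ S₁`, or the Hodge group splits by §1 and
both surfaces satisfy (D)). [cite: MoonenZarhin1999LowDim, Thm. (0.1)(4) (p0001 L131–L135), §3 Lemma (3.3)–(3.4), §5 (5.5) (p0009 L93–L100)]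
[cite: Gordon1999HodgeAVSurvey, Thm. 7.5 and 7.6] -/
theorem IsAbelianVariety.forall_divisorClasses_powPeriod_prod_eq_hodgeClasses_of_finrank_eq_two_of_endAlgRat_eq_bot
    (hS₁ : IsAbelianVariety Φ₁) (h2₁ : finrank ℂ E₁ = 2) (hE₁ : endAlgRat Φ₁ = ⊥) (hS₂ : IsAbelianVariety Φ₂)
    (h2₂ : finrank ℂ E₂ = 2) :
    ∀ k p, divisorClasses (powPeriod (prodPeriod Φ₁ Φ₂) k) p = hodgeClasses (powPeriod (prodPeriod Φ₁ Φ₂) k) p := by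
  haveI : Nonempty ι₁ := nonempty_of_finrank_eq_two₁₃₁ Φ₁ h2₁
  haveI : Nonempty ι₂ := nonempty_of_finrank_eq_two₁₃₁ Φ₂ h2₂
  by_cases hE₂ : endAlgRat Φ₂ = ⊥
  · by_cases hiso : IsIsogenous Φ₁ Φ₂
    · exact hiso.symm.forall_divisorClasses_powPeriod_prod_eq_hodgeClasses_of_finrank_eq_two Φ₂ hS₁ h2₁
    · exact forall_divisorClasses_powPeriod_prod_eq_hodgeClasses_of_hodgeGroupC_prod_eq
        (hS₁.hodgeGroupC_prod_eq_blockDiagProd_of_finrank_eq_two_of_endAlgRat_eq_bot_of_not_isIsogenous hS₂ h2₁ h2₂ hE₁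
          hE₂ hiso)
        (hS₁.forall_divisorClasses_powPeriod_eq_hodgeClasses_of_finrank_eq_two h2₁)
        (hS₂.forall_divisorClasses_powPeriod_eq_hodgeClasses_of_finrank_eq_two h2₂)
  · exact hS₁.forall_divisorClasses_powPeriod_prod_eq_hodgeClasses_of_finrank_eq_two_of_endAlgRat_eq_bot_of_ne_bot Φ₂ h2₁
      hE₁ hS₂ h2₂ hE₂

/-- The mirror: `S₁` ANY abelian surface, `End_ℚ(S₂) = ℚ` ⟹ (D) on all powers of `S₁ × S₂` (`S₁ × S₂ ≅ S₂ × S₁`).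
[cite: MoonenZarhin1999LowDim, Thm. (0.1)(4), §3 Lemma (3.3)–(3.4), §5 (5.5)] -/
theorem IsAbelianVariety.forall_divisorClasses_powPeriod_prod_eq_hodgeClasses_of_finrank_eq_two_of_endAlgRat_eq_bot_right
    (hS₁ : IsAbelianVariety Φ₁) (h2₁ : finrank ℂ E₁ = 2) (hS₂ : IsAbelianVariety Φ₂) (h2₂ : finrank ℂ E₂ = 2)
    (hE₂ : endAlgRat Φ₂ = ⊥) :
    ∀ k p, divisorClasses (powPeriod (prodPeriod Φ₁ Φ₂) k) p = hodgeClasses (powPeriod (prodPeriod Φ₁ Φ₂) k) p :=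
  (isIsomorphic_prodPeriod_comm Φ₁ Φ₂).isIsogenous.forall_powPeriod_divisorClasses_eq_hodgeClasses_iff.2
    (hS₂.forall_divisorClasses_powPeriod_prod_eq_hodgeClasses_of_finrank_eq_two_of_endAlgRat_eq_bot h2₂ hE₂ hS₁ h2₁)

/-- **MOONEN–ZARHIN THM. (0.1)(4) FOR `Y₁ × Y₂`, ALL CASES EXCEPT «BOTH SIMPLE, NON-ISOGENOUS, `End_ℚ ≠ ℚ`»** (Thm. (3.2) ∕
Prop. (4.2)): polarised abelian surfaces `Y₁`, `Y₂` with `End_ℚ(Y₁) = ℚ` or `End_ℚ(Y₂) = ℚ` or `Y₁` or `Y₂` non-simple or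
`Y₂ ∼ Y₁` ⟹ `Y₁ × Y₂` satisfies condition (D) (extends g51-#7's `…_of_not_isSimple_or_isIsogenous`).
[cite: MoonenZarhin1999LowDim, Thm. (0.1)(4) (p0001 L131–L135) and §5 (5.5) (p0009 L93–L100)] -/
theorem IsRiemannForm.forall_divisorClasses_powPeriod_prod_eq_hodgeClasses_of_finrank_eq_two_of_endAlgRat_eq_bot_or
    (hη₁ : IsRiemannForm Φ₁ η₁) (hη₂ : IsRiemannForm Φ₂ η₂) (h2₁ : finrank ℂ E₁ = 2) (h2₂ : finrank ℂ E₂ = 2)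
    (h : endAlgRat Φ₁ = ⊥ ∨ endAlgRat Φ₂ = ⊥ ∨ ¬ IsSimple Φ₁ ∨ ¬ IsSimple Φ₂ ∨ IsIsogenous Φ₂ Φ₁) :
    ∀ k p, divisorClasses (powPeriod (prodPeriod Φ₁ Φ₂) k) p = hodgeClasses (powPeriod (prodPeriod Φ₁ Φ₂) k) p := by
  rcases h with h | h | h
  · exact IsAbelianVariety.forall_divisorClasses_powPeriod_prod_eq_hodgeClasses_of_finrank_eq_two_of_endAlgRat_eq_bot
      ⟨η₁, hη₁⟩ h2₁ h ⟨η₂, hη₂⟩ h2₂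
  · exact IsAbelianVariety.forall_divisorClasses_powPeriod_prod_eq_hodgeClasses_of_finrank_eq_two_of_endAlgRat_eq_bot_right
      ⟨η₁, hη₁⟩ h2₁ ⟨η₂, hη₂⟩ h2₂ h
  · exact hη₁.forall_divisorClasses_powPeriod_prod_eq_hodgeClasses_of_finrank_eq_two_of_not_isSimple_or_isIsogenous hη₂ h2₁
      h2₂ h

/-- `IsAbelianVariety` form of the fourfold assembly. [cite: MoonenZarhin1999LowDim, Thm. (0.1)(4) and §5 (5.5)] -/
theorem IsAbelianVariety.forall_divisorClasses_powPeriod_prod_eq_hodgeClasses_of_finrank_eq_two_of_endAlgRat_eq_bot_or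
    (hS₁ : IsAbelianVariety Φ₁) (hS₂ : IsAbelianVariety Φ₂) (h2₁ : finrank ℂ E₁ = 2) (h2₂ : finrank ℂ E₂ = 2)
    (h : endAlgRat Φ₁ = ⊥ ∨ endAlgRat Φ₂ = ⊥ ∨ ¬ IsSimple Φ₁ ∨ ¬ IsSimple Φ₂ ∨ IsIsogenous Φ₂ Φ₁) :
    ∀ k p, divisorClasses (powPeriod (prodPeriod Φ₁ Φ₂) k) p = hodgeClasses (powPeriod (prodPeriod Φ₁ Φ₂) k) p := by
  obtain ⟨η₁, hη₁⟩ := hS₁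
  obtain ⟨η₂, hη₂⟩ := hS₂
  exact hη₁.forall_divisorClasses_powPeriod_prod_eq_hodgeClasses_of_finrank_eq_two_of_endAlgRat_eq_bot_or hη₂ h2₁ h2₂ h

variable {ι : Type} [Fintype ι] [DecidableEq ι] {E : Type} [NormedAddCommGroup E] [NormedSpace ℂ E] {Φ : (ι → ℝ) ≃L[ℝ] E}

/-- **EVERY COMPLEX TORUS ISOGENOUS TO `Y₁ × Y₂`** (`Y₁`, `Y₂` polarised abelian surfaces, `End_ℚ(Y₁) = ℚ` or `End_ℚ(Y₂) = ℚ` or a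
factor non-simple or `Y₂ ∼ Y₁`) **satisfies condition (D).** [cite: MoonenZarhin1999LowDim, Thm. (0.1)(4) and §5 (5.4)–(5.5) (p0009 L82–L100)] -/
theorem IsIsogenous.forall_divisorClasses_powPeriod_eq_hodgeClasses_of_prod_of_finrank_eq_two_of_endAlgRat_eq_bot_or
    (hiso : IsIsogenous Φ (prodPeriod Φ₁ Φ₂)) (hη₁ : IsRiemannForm Φ₁ η₁) (hη₂ : IsRiemannForm Φ₂ η₂)
    (h2₁ : finrank ℂ E₁ = 2) (h2₂ : finrank ℂ E₂ = 2)
    (h : endAlgRat Φ₁ = ⊥ ∨ endAlgRat Φ₂ = ⊥ ∨ ¬ IsSimple Φ₁ ∨ ¬ IsSimple Φ₂ ∨ IsIsogenous Φ₂ Φ₁) :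
    ∀ k p, divisorClasses (powPeriod Φ k) p = hodgeClasses (powPeriod Φ k) p :=
  hiso.forall_powPeriod_divisorClasses_eq_hodgeClasses_iff.2
    (hη₁.forall_divisorClasses_powPeriod_prod_eq_hodgeClasses_of_finrank_eq_two_of_endAlgRat_eq_bot_or hη₂ h2₁ h2₂ h)

universe u

variable {κ : Type*} [Fintype κ] [DecidableEq κ] {E' : Type u} [NormedAddCommGroup E'] [InnerProductSpace ℂ E']
  [FiniteDimensional ℂ E'] [MeasurableSpace E'] [BorelSpace E'] (Ψ : (κ → ℝ) ≃L[ℝ] E') {q : ℕ} (e : Fin q ≃ κ)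

/-- **The Hodge `(p,p)`-conjecture in cycle form, `Aᵖ = Bᵖ`, for every inner-product torus isogenous to a power of `S₁ × S₂`**,
`S₁` an abelian surface with `End_ℚ(S₁) = ℚ`, `S₂` any abelian surface. [cite: MoonenZarhin1999LowDim, Thm. (0.1)(4) and §1 (1.5) (p0004 L61–L66)]
[cite: Lange2023AbelianVarietiesComplex, §7.3.1 (p. 336) and §7.3.3 Exercise (1)(b)] -/
theorem IsIsogenous.forall_analyticClasses_eq_hodgeClasses_of_powPeriod_prod_of_finrank_eq_two_of_endAlgRat_eq_bot {k : ℕ}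
    (hY : IsIsogenous Ψ (powPeriod (prodPeriod Φ₁ Φ₂) k)) (hS₁ : IsAbelianVariety Φ₁) (h2₁ : finrank ℂ E₁ = 2)
    (hE₁ : endAlgRat Φ₁ = ⊥) (hS₂ : IsAbelianVariety Φ₂) (h2₂ : finrank ℂ E₂ = 2) (p : ℕ) :
    analyticClasses Ψ e p = hodgeClasses Ψ p :=
  hY.forall_analyticClasses_eq_hodgeClasses_of_powPeriod_of_forall_powPeriod Ψ e (hS₁.prod hS₂)
    (hS₁.forall_divisorClasses_powPeriod_prod_eq_hodgeClasses_of_finrank_eq_two_of_endAlgRat_eq_bot h2₁ hE₁ hS₂ h2₂) p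

/-- Cycle form for the fourfold assembly: `Aᵖ = Bᵖ` for every inner-product torus isogenous to a power of `Y₁ × Y₂` as in
`…_of_endAlgRat_eq_bot_or`. [cite: MoonenZarhin1999LowDim, Thm. (0.1)(4) and §1 (1.5)] [cite: Lange2023AbelianVarietiesComplex, §7.3.3 Exercise (1)(b)] -/
theorem IsIsogenous.forall_analyticClasses_eq_hodgeClasses_of_powPeriod_prod_of_finrank_eq_two_of_endAlgRat_eq_bot_or {k : ℕ}
    (hY : IsIsogenous Ψ (powPeriod (prodPeriod Φ₁ Φ₂) k)) (hS₁ : IsAbelianVariety Φ₁) (hS₂ : IsAbelianVariety Φ₂)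
    (h2₁ : finrank ℂ E₁ = 2) (h2₂ : finrank ℂ E₂ = 2)
    (h : endAlgRat Φ₁ = ⊥ ∨ endAlgRat Φ₂ = ⊥ ∨ ¬ IsSimple Φ₁ ∨ ¬ IsSimple Φ₂ ∨ IsIsogenous Φ₂ Φ₁) (p : ℕ) :
    analyticClasses Ψ e p = hodgeClasses Ψ p :=
  hY.forall_analyticClasses_eq_hodgeClasses_of_powPeriod_of_forall_powPeriod Ψ e (hS₁.prod hS₂)
    (hS₁.forall_divisorClasses_powPeriod_prod_eq_hodgeClasses_of_finrank_eq_two_of_endAlgRat_eq_bot_or hS₂ h2₁ h2₂ h) p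

end ConditionD

end ComplexTorus

end Literature.Geometry.Kaehler
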